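import Literature.Computability.QuantumComplexity.HybridArgumentSets
import Literature.Computability.QuantumComplexity.BQPCollapsingOracle
import Literature.Computability.QuantumComplexity.FortnowRogersWorlds
import Literature.Computability.Complexity.BrainProtocol
import HarnessLib

/-!
# The Fortnow–Rogers brain oracle `K`: `BQP^{K ⊕ G} ⊆ P^{K ⊕ G}` for every `G` with at most one string per length (Fortnow–Rogers 1999, proof of Thm. 4.2, second half)

Topic `Computability/QuantumComplexity` (family `quantum-advantage`). Fortnow–Rogers (JCSS 1999,
Thm. 4.2) build `C = H ⊕ G` with `H` `PSPACE`-complete and `G` holding one string per acceptable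
length, and prove `P^C = BQP^C` as follows (p. 7): a deterministic machine `N` simulating the
`BQP^C` machine `M` on `x` finds the short strings of `G` by brute force; for the one long length
`ℓ` it "can use its access to `H` to figure out what `M` would do on input `x` under the
assumption that there are no strings of length `ℓ` in `G`", asks `H` for the set `S` of Thm. 4.3
(BBBV) — "This question can be answered in PSPACE without querying `G`" — "then queries `G` for
each of those strings. If none of those strings are in `G` then `N` accepts input `x` because
that is what `M` would do. If `N` finds one of those strings in `G`, it would then be able to
simulate the computation of `M(x)` with full knowledge".

This file proves the corresponding statement in the tree's models — `BQPRel` (uniform Clifford+T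
families with XOR-query gates) and `PRel` (transcript model) — by the same mechanism, with two
changes that only simplify: (1) instead of a `PSPACE`-complete `H` we use a **self-encoding brain
oracle** `K = FRBrain.oracleK` (Ko's encoding technique, as in the tree's
`BQPCollapsingOracle.lean`: the answer to a question of length `L` may depend on `K` below `L`),
which answers, one bit per round, the questions of the `P^{K ⊕ G}` protocol machine of
`Complexity/BrainProtocol.lean`; (2) instead of brute-forcing short lengths we treat ALL unknown
strings of `G` below the circuit width at once with the many-strings BBBV bound
(`HybridArgumentSets.lean`) and a fixed-point loop: the brain keeps asking for probes of the
not-yet-probed strings `z` with `1z` in the sensitive set `S(B)` of the circuit relative to its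
current base oracle `B = K_{<W} ⊕ (strings found so far)`, recomputing `S(B)` as strings are
found, and halts with the verdict `[Pr_B(accept) ≥ 1/2]` when every such string has been probed.
At that point the strings of `G` still unknown avoid `S(B)`, so `|Pr_C − Pr_B| ≤ 1/8` and the
verdict is `[x ∈ L]` by the `2/3`-vs-`1/3` promise of the `BQP^C` machine AT THE TRUE ORACLE (no
genericity or categoricity is needed). The loop is polynomial: the set of found strings only
grows inside `G ∩ {0,1}^{<W}` (at most `W` values when `G` has at most one string per length),
and for each value at most `|S| ≤ 256 T² W` probes are made.

**Relation to the tree's other attack on the same target.** `FortnowRogersWorlds.lean` builds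
oracle worlds `FRO.world p a b ref` whose code strings are valued, with a promise gap, relative
to the WHOLE world including its reserved (witness) part, and proves `BQP^W ⊆ P^W` for them
(`FRO.BQPRel_world_subset_PRel`, a Karp reduction as in `BQPCollapse`); there the separation
half must then be a diagonalization that respects the self-reference of the codes. Here, by
contrast, the brain `oracleK` is INDEPENDENT of `G` — it never looks at `G`, the probe answers
reach it only through the transcript — and the collapse `BQP^{K ⊕ G} ⊆ P^{K ⊕ G}` holds for
every thin `G` (`BQPRel_joinLang_oracleK_subset_PRel`); this independence is what lets the
`UP ∩ coUP` half be a plain Baker–Gill–Solovay diagonalization against `P^{K ⊕ G}` for the fixed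
`K` (`Complexity/UPDiagonalOracle.lean`). The price is the BBBV analysis and the protocol
machine instead of a one-query reduction.

Main declarations (`namespace FRBrain`):

* `plan Kb x m C` — the brain of the instance (input `x`, circuit `C` on `|x| + m` wires, base
  part `Kb`); `heavy` (the BBBV set, by choice from
  `exists_finset_abs_acceptProb_sub_le_of_card_le_cliffordT`), `cands`, `known`, `probed`;
* `oracleK` — the brain oracle `FRO.build KHolds`, by the tree's recursion-on-length builder
  `FRO.build` of `FortnowRogersWorlds.lean` (`mem_oracleK_iff`,
  `mem_oracleK_question_iff`: `K` answers the protocol's questions with `kbit plan`);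
* `exists_halt` — the loop halts within `(W + 1)(256 T² W + 1)` probes;
* `verdict_iff` — the halting verdict is `[x ∈ L]`;
* **`BQPRel_joinLang_oracleK_subset_PRel`** — `BQP^{K ⊕ G} ⊆ P^{K ⊕ G}` for every `G` with at
  most one string of each length.

## References

* [FortnowRogers1999JCSS] L. Fortnow, J. Rogers, *Complexity limitations on quantum
  computation*, JCSS 59 (1999) 240–252 (arXiv:cs/9811023): Thm. 4.2, Thm. 4.3 and the proof of
  Thm. 4.2 (p. 7).
* [BennettBernsteinBrassardVazirani1997] C. H. Bennett, E. Bernstein, G. Brassard, U. Vazirani,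
  *Strengths and weaknesses of quantum computing*, SIAM J. Comput. 26 (1997), Thm. 3.3, Cor. 3.4.
* [Ko1989] K.-I Ko, *Constructing oracles by lower bound techniques for circuits*, 1989, §5
  (p. 21: self-encoding complete sets `K(A)` depending only on `A_{<|x|}`).
-/

noncomputable section

namespace Literature.Computability.QuantumComplexity

open _root_.Computability Complexity Complexity.Classes Cryptography Complexity.BrainProtocol

namespace FRBrain

/-! ### The brain of an instance -/

/-- The strings found in `G` so far: the probes answered yes. [cite: FortnowRogers1999JCSS, proof of Thm. 4.2 (p. 7)] -/
def known (R : List (List Bool × Bool)) : Finset (List Bool) :=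
  ((R.filter fun p => p.2).map Prod.fst).toFinset

/-- The strings probed so far. [folklore] -/
def probed (R : List (List Bool × Bool)) : Finset (List Bool) :=
  (R.map Prod.fst).toFinset

/-- Membership in `known`. [folklore] -/
theorem mem_known_iff {R : List (List Bool × Bool)} {z : List Bool} : z ∈ known R ↔ (z, true) ∈ R := by
  unfold known
  rw [List.mem_toFinset, List.mem_map]
  constructor
  · rintro ⟨⟨a, b⟩, hab, rfl⟩
    obtain ⟨h, hb⟩ := List.mem_filter.1 hab
    change b = true at hb
    subst hb
    exact h
  · exact fun h => ⟨(z, true), List.mem_filter.2 ⟨h, rfl⟩, rfl⟩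

/-- Membership in `probed`. [folklore] -/
theorem mem_probed_iff {R : List (List Bool × Bool)} {z : List Bool} : z ∈ probed R ↔ ∃ a, (z, a) ∈ R := by
  simp [probed]

/-- `known` is monotone along prefixes. [folklore] -/
theorem known_mono {R R' : List (List Bool × Bool)} (h : R <+: R') : known R ⊆ known R' :=
  fun _ hz => mem_known_iff.2 (h.subset (mem_known_iff.1 hz))

/-- Known strings were probed. [folklore] -/
theorem known_subset_probed (R : List (List Bool × Bool)) : known R ⊆ probed R :=
  fun _ hz => mem_probed_iff.2 ⟨true, mem_known_iff.1 hz⟩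

variable (Kb : Set (List Bool))

/-- The base oracle of the brain: its own lower part `Kb` joined with the strings found so far
("under the assumption that there are no [other] strings … in `G`").
[cite: FortnowRogers1999JCSS, proof of Thm. 4.2 (p. 7)] -/
def base (R : List (List Bool × Bool)) : Set (List Bool) := joinLang Kb ↑(known R)

section Instance

variable {n m : ℕ} (C : QCircuit cliffordT (n + m))

/-- **The sensitive set** of the circuit relative to the oracle `A` on input `x`: a set `S` of
strings of length `< n + m`, `|S| ≤ 256 T² (n + m)`, such that changing `A` on at most `n + m`
strings avoiding `S` moves the acceptance probability by at most `1/8` (the many-strings form,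
`HybridArgumentSets.lean`, of BBBV Cor. 3.4 / Fortnow–Rogers' single-string Thm. 4.3, with
`ε = 1/8`). [cite: BennettBernsteinBrassardVazirani1997, Thm. 3.3 and Cor. 3.4] [cite: FortnowRogers1999JCSS, Thm. 4.3 (arXiv numbering; single-string form)] -/
def heavy (A : Set (List Bool)) (x : QReg n) : Finset (List Bool) :=
  Classical.choose (exists_finset_abs_acceptProb_sub_le_of_card_le_cliffordT C A x
    (ε := 1 / 8) (by norm_num) (n + m))

/-- Specification of the sensitive set (many-strings BBBV, `HybridArgumentSets.lean`). [cite: BennettBernsteinBrassardVazirani1997, Thm. 3.3 and Cor. 3.4] -/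
theorem heavy_spec (A : Set (List Bool)) (x : QReg n) :
    (∀ s ∈ heavy C A x, s.length < n + m) ∧
      ((heavy C A x).card : ℝ) ≤ 4 * (C.oracleQueries : ℝ) ^ 2 * ((n + m : ℕ) : ℝ) / (1 / 8) ^ 2 ∧
      ∀ (B : Language Bool) (D : Finset (List Bool)), D.card ≤ n + m → Disjoint D (heavy C A x) →
        (∀ w, w ∉ D → (w ∈ A ↔ w ∈ B)) → |C.acceptProb B x - C.acceptProb A x| ≤ 1 / 8 :=
  Classical.choose_spec (exists_finset_abs_acceptProb_sub_le_of_card_le_cliffordT C A x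
    (ε := 1 / 8) (by norm_num) (n + m))

/-- The sensitive set has at most `256 T² (n + m)` elements. [cite: BennettBernsteinBrassardVazirani1997, Cor. 3.4] -/
theorem card_heavy_le (A : Set (List Bool)) (x : QReg n) :
    (heavy C A x).card ≤ 256 * C.oracleQueries ^ 2 * (n + m) := by
  have h := (heavy_spec C A x).2.1
  have h' : ((heavy C A x).card : ℝ) ≤ ((256 * C.oracleQueries ^ 2 * (n + m) : ℕ) : ℝ) := by
    refine h.trans (le_of_eq ?_)
    push_cast
    ring
  exact_mod_cast h'

/-- **The probe candidates**: the strings `z` with `1z` sensitive that have not been probed.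
[cite: FortnowRogers1999JCSS, proof of Thm. 4.2 (p. 7: "It then queries G for each of those strings")] -/
def cands (S : Finset (List Bool)) (R : List (List Bool × Bool)) : Finset (List Bool) :=
  ((S.filter fun s => s.head? = some true).image List.tail).filter fun z => z ∉ probed R

/-- Membership in the candidates. [folklore] -/
theorem mem_cands_iff {S : Finset (List Bool)} {R : List (List Bool × Bool)} {z : List Bool} :
    z ∈ cands S R ↔ true :: z ∈ S ∧ z ∉ probed R := by
  simp only [cands, Finset.mem_filter, Finset.mem_image]
  constructor
  · rintro ⟨⟨s, ⟨hs, hh⟩, rfl⟩, hp⟩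
    cases s with
    | nil => simp at hh
    | cons b s =>
      simp only [List.head?_cons, Option.some.injEq] at hh
      subst hh
      exact ⟨hs, hp⟩
  · rintro ⟨hs, hp⟩
    exact ⟨⟨true :: z, ⟨hs, rfl⟩, rfl⟩, hp⟩

variable (x : List Bool) (m' : ℕ) (C' : QCircuit cliffordT (x.length + m'))

/-- **The brain of the instance** `(x, C')`: probe some unprobed `z` with `1z` sensitive for the
current base oracle; when none is left, halt with the verdict `[Pr_base(accept) ≥ 1/2]`.
[cite: FortnowRogers1999JCSS, proof of Thm. 4.2 (p. 7)] -/
def plan (R : List (List Bool × Bool)) : Action :=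
  match (cands (heavy C' (base Kb R) x.get) R).toList with
  | z :: _ => .probe z
  | [] => .halt (decide ((1 / 2 : ℝ) ≤ C'.acceptProb (base Kb R) x.get))

/-- A probe of the brain is a candidate. [folklore] -/
theorem mem_cands_of_plan_eq_probe {R : List (List Bool × Bool)} {z : List Bool}
    (h : plan Kb x m' C' R = .probe z) : z ∈ cands (heavy C' (base Kb R) x.get) R := by
  unfold plan at h
  split at h
  · rename_i z' l hl
    cases h
    exact Finset.mem_toList.1 (by rw [hl]; exact List.mem_cons_self)
  · cases h

/-- When the brain halts no candidate is left, and the verdict is the threshold bit. [folklore] -/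
theorem plan_eq_halt_iff {R : List (List Bool × Bool)} {v : Bool} :
    plan Kb x m' C' R = .halt v ↔
      cands (heavy C' (base Kb R) x.get) R = ∅ ∧ v = decide ((1 / 2 : ℝ) ≤ C'.acceptProb (base Kb R) x.get) := by
  unfold plan
  split
  · rename_i z l hl
    constructor
    · intro h; cases h
    · rintro ⟨h, -⟩
      rw [Finset.toList_eq_nil.2 h] at hl
      cases hl
  · rename_i hl
    rw [Finset.toList_eq_nil] at hl
    constructor
    · intro h; cases h; exact ⟨hl, rfl⟩
    · rintro ⟨-, rfl⟩; rfl

/-- Probed strings are short: a probe `z` has `|z| + 1 < |x| + m'`. [folklore] -/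
theorem length_lt_of_plan_eq_probe {R : List (List Bool × Bool)} {z : List Bool}
    (h : plan Kb x m' C' R = .probe z) : z.length + 1 < x.length + m' := by
  have hz := (mem_cands_iff.1 (mem_cands_of_plan_eq_probe Kb x m' C' h)).1
  have := (heavy_spec C' (base Kb R) x.get).1 _ hz
  simpa using this

end Instance

/-! ### The brain oracle `K` (Ko's recursion on length, `FRO.build`) -/

/-- The part of a language below length `W` (what a circuit on `W` wires can see of it).
[cite: Ko1989, §5 (p. 21)] -/
def trunc (S : Set (List Bool)) (W : ℕ) : Set (List Bool) := {c | c ∈ S ∧ c.length < W}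

/-- `KHolds S u`: `u` is a protocol question `⟨⟨x, sigmaEncode ⟨|x|, m, C⟩⟩, h⟩` and the brain
of the instance `(x, C)` with base part `S` below the circuit width, having parsed the history `h`,
says `1`. [cite: FortnowRogers1999JCSS, proof of Thm. 4.2 (p. 7)] [cite: Ko1989, §5 (p. 21)] -/
def KHolds (S : Set (List Bool)) (u : List Bool) : Prop :=
  ∃ (x : List Bool) (m : ℕ) (C : QCircuit cliffordT (x.length + m)) (h : List Bool),
    u = boolPair (BQPCollapse.code x m C) h ∧ kbit (plan (trunc S (x.length + m)) x m C) h = true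

/-- **The brain oracle `K`**: the language built from the rule `KHolds` by recursion on length
(`FRO.build`, `FortnowRogersWorlds.lean`). [cite: FortnowRogers1999JCSS, proof of Thm. 4.2 (p. 7)] [cite: Ko1989, §5 (p. 21)] -/
def oracleK : Set (List Bool) := FRO.build KHolds

/-- **The fixed-point equation of `K`**: `u ∈ K ↔ KHolds (K below |u|) u`. [cite: Ko1989, §5 (p. 21)] -/
theorem mem_oracleK_iff (u : List Bool) : u ∈ oracleK ↔ KHolds (FRO.belowB KHolds u.length) u :=
  FRO.mem_build_iff u

/-- Below the width, the stage language and `K` agree: `trunc (K below n) W = trunc K W` for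
`W ≤ n`. [cite: Ko1989, §5 (p. 21)] -/
theorem trunc_belowB_eq {W n : ℕ} (h : W ≤ n) : trunc (FRO.belowB KHolds n) W = trunc oracleK W := by
  ext c
  simp only [trunc, Set.mem_setOf_eq, FRO.mem_belowB_iff]
  constructor
  · rintro ⟨⟨hc, -⟩, hl⟩; exact ⟨hc, hl⟩
  · rintro ⟨hc, hl⟩; exact ⟨⟨hc, lt_of_lt_of_le hl h⟩, hl⟩

/-- **`K` answers the protocol's questions**: on the question `⟨code x m C, h⟩` the oracle `K`
says the brain's bit `kbit (plan (K_{<|x|+m}) x m C) h` — the circuit queries only strings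
shorter than its width, which is smaller than the length of the question.
[cite: FortnowRogers1999JCSS, proof of Thm. 4.2 (p. 7)] [cite: Ko1989, §5 (p. 21)] -/
theorem mem_oracleK_question_iff (x : List Bool) (m : ℕ) (C : QCircuit cliffordT (x.length + m)) (h : List Bool) :
    boolPair (BQPCollapse.code x m C) h ∈ oracleK ↔ kbit (plan (trunc oracleK (x.length + m)) x m C) h = true := by
  rw [mem_oracleK_iff]
  have hW : x.length + m ≤ (boolPair (BQPCollapse.code x m C) h).length := by
    have := BQPCollapse.lt_length_code x m C
    rw [length_boolPair]; omega
  constructor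
  · rintro ⟨x', m', C', h', hu, hk⟩
    obtain ⟨hc, hh⟩ := QCircuit.boolPair_inj hu
    obtain ⟨rfl, rfl, rfl⟩ := BQPCollapse.code_inj hc
    subst hh
    rwa [trunc_belowB_eq hW] at hk
  · intro hk
    exact ⟨x, m, C, h, rfl, by rwa [trunc_belowB_eq hW]⟩

/-! ### The loop halts -/

section Halting

variable {n m : ℕ} (C : QCircuit cliffordT (n + m)) (x : List Bool) (m' : ℕ)
  (C' : QCircuit cliffordT (x.length + m')) (G : Set (List Bool))

/-- The strings of `G` below length `W`, as a finite set, when `G` has at most one string per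
length. [folklore] -/
theorem finite_lowG (W : ℕ) : {z : List Bool | z ∈ G ∧ z.length < W}.Finite :=
  (List.finite_length_lt Bool W).subset fun _ hz => hz.2

/-- At most `W` strings of `G` have length `< W`. [folklore] -/
theorem ncard_lowG_le (hG : ∀ ℓ, {z : List Bool | z ∈ G ∧ z.length = ℓ}.Subsingleton) (W : ℕ) :
    (finite_lowG G W).toFinset.card ≤ W := by
  have hinj : Set.InjOn List.length {z : List Bool | z ∈ G ∧ z.length < W} :=
    fun z hz z' hz' h => hG z.length ⟨hz.1, rfl⟩ ⟨hz'.1, h.symm⟩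
  calc (finite_lowG G W).toFinset.card
      = ((finite_lowG G W).toFinset.image List.length).card := by
        rw [Finset.card_image_of_injOn (by simpa using hinj)]
    _ ≤ (Finset.range W).card := Finset.card_le_card fun ℓ hℓ => by
        obtain ⟨z, hz, rfl⟩ := Finset.mem_image.1 hℓ
        exact Finset.mem_range.2 ((Set.Finite.mem_toFinset _).1 hz).2
    _ = W := Finset.card_range W

variable {x m' C' G} (Kb : Set (List Bool))

/-- Along the canonical run the found strings are in `G` and short. [folklore] -/
theorem known_results_subset (J : ℕ) :
    ↑(known (results (plan Kb x m' C') G.boolIndicator J)) ⊆ {z : List Bool | z ∈ G ∧ z.length < x.length + m'} := by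
  intro z hz
  have hmem := mem_known_iff.1 (Finset.mem_coe.1 hz)
  have ha := results_answer (plan := plan Kb x m' C') G.boolIndicator J hmem
  simp only at ha
  refine ⟨(Set.mem_iff_boolIndicator _ _).2 ha.symm, ?_⟩
  -- `z` was probed at some stage, hence is a candidate there
  obtain ⟨J', -, hz'⟩ : ∃ J' ≤ J, plan Kb x m' C' (results (plan Kb x m' C') G.boolIndicator J') = .probe z := by
    clear ha hz
    induction J with
    | zero => simp [results] at hmem
    | succ J ih =>
      cases hq : plan Kb x m' C' (results (plan Kb x m' C') G.boolIndicator J) with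
      | halt v =>
        rw [results_succ_of_halt G.boolIndicator hq] at hmem
        obtain ⟨J', hJ', h⟩ := ih hmem
        exact ⟨J', Nat.le_succ_of_le hJ', h⟩
      | probe z' =>
        rw [results_succ_of_probe G.boolIndicator hq, List.mem_append, List.mem_singleton] at hmem
        rcases hmem with hmem | hmem
        · obtain ⟨J', hJ', h⟩ := ih hmem
          exact ⟨J', Nat.le_succ_of_le hJ', h⟩
        · obtain ⟨hzz, -⟩ := (Prod.mk.injEq _ _ _ _).mp hmem
          subst hzz
          exact ⟨J, Nat.le_succ J, hq⟩
  have := length_lt_of_plan_eq_probe Kb x m' C' hz'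
  omega

/-- **The loop halts within `(W + 1)(256 T² W + 1)` probes**, `W = |x| + m'`, when `G` has at
most one string per length: the found strings only grow inside `G ∩ {0,1}^{<W}` (at most
`W + 1` values), and for each value the probes are distinct tails of strings of one sensitive
set. [cite: FortnowRogers1999JCSS, proof of Thm. 4.2 (p. 7)] -/
theorem exists_halt (hG : ∀ ℓ, {z : List Bool | z ∈ G ∧ z.length = ℓ}.Subsingleton) :
    ∃ J ≤ (x.length + m' + 1) * (256 * C'.oracleQueries ^ 2 * (x.length + m') + 1), ∃ v,
      plan Kb x m' C' (results (plan Kb x m' C') G.boolIndicator J) = .halt v := by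
  classical
  by_contra hcon
  push Not at hcon
  obtain ⟨smax, hsmax⟩ : ∃ smax, smax = 256 * C'.oracleQueries ^ 2 * (x.length + m') := ⟨_, rfl⟩
  obtain ⟨Jm, hJm⟩ : ∃ Jm, Jm = (x.length + m' + 1) * (smax + 1) := ⟨_, rfl⟩
  rw [← hsmax, ← hJm] at hcon
  -- all stages `J ≤ Jm` probe
  have hprobe : ∀ J ≤ Jm, ∃ z, plan Kb x m' C' (results (plan Kb x m' C') G.boolIndicator J) = .probe z := by
    intro J hJ
    cases hq : plan Kb x m' C' (results (plan Kb x m' C') G.boolIndicator J) with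
    | probe z => exact ⟨z, rfl⟩
    | halt v => exact absurd hq (hcon J hJ v)
  choose! zf hzf using hprobe
  -- the probes are pairwise distinct
  have hmemR : ∀ J ≤ Jm, ∀ J', J < J' →
      (zf J, G.boolIndicator (zf J)) ∈ results (plan Kb x m' C') G.boolIndicator J' := by
    intro J hJ J' hJJ'
    have h1 := results_succ_eq_of_forall_probe (plan := plan Kb x m' C') G.boolIndicator (hzf J hJ)
    exact (results_prefix (plan := plan Kb x m' C') G.boolIndicator (Nat.succ_le_of_lt hJJ')).subset h1
  -- `zf J'` is a candidate at stage `J'`, hence not probed, but every earlier probe was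
  have key : ∀ J J', J < J' → J' ≤ Jm → zf J ≠ zf J' := by
    intro J J' hlt hJ' heq
    have hc := mem_cands_of_plan_eq_probe Kb x m' C' (hzf J' hJ')
    have hnp := (mem_cands_iff.1 hc).2
    refine hnp (mem_probed_iff.2 ⟨G.boolIndicator (zf J), ?_⟩)
    rw [← heq]
    exact hmemR J (le_of_lt (lt_of_lt_of_le hlt hJ')) J' hlt
  have hinj : Set.InjOn zf ↑(Finset.range (Jm + 1)) := by
    intro J hJ J' hJ' heq
    simp only [Finset.coe_range, Set.mem_Iio, Nat.lt_succ_iff] at hJ hJ'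
    rcases lt_trichotomy J J' with h | h | h
    · exact absurd heq (key J J' h hJ')
    · exact h
    · exact absurd heq.symm (key J' J h hJ)
  -- the values of `known` along the run form a chain of subsets of the low part of `G`
  have hsub : ∀ J, known (results (plan Kb x m' C') G.boolIndicator J) ⊆ (finite_lowG G (x.length + m')).toFinset :=
    fun J z hz => (Set.Finite.mem_toFinset _).2 (known_results_subset Kb J (Finset.mem_coe.2 hz))
  obtain ⟨V, hV⟩ : ∃ V : Finset (Finset (List Bool)),
      V = (Finset.range (Jm + 1)).image fun J => known (results (plan Kb x m' C') G.boolIndicator J) := ⟨_, rfl⟩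
  have hVcard : V.card ≤ x.length + m' + 1 := by
    -- `card` is injective on the chain `V`, with values in `{0, …, |lowG|}`
    have hchain : Set.InjOn Finset.card (↑V : Set (Finset (List Bool))) := by
      intro D hD D' hD' hc
      rw [hV] at hD hD'
      obtain ⟨J, -, rfl⟩ := Finset.mem_image.1 (Finset.mem_coe.1 hD)
      obtain ⟨J', -, rfl⟩ := Finset.mem_image.1 (Finset.mem_coe.1 hD')
      rcases le_total J J' with h | h
      · exact Finset.eq_of_subset_of_card_le (known_mono (results_prefix (plan := plan Kb x m' C') _ h)) hc.ge
      · exact (Finset.eq_of_subset_of_card_le (known_mono (results_prefix (plan := plan Kb x m' C') _ h)) hc.le).symm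
    calc V.card = (V.image Finset.card).card := by rw [Finset.card_image_of_injOn hchain]
      _ ≤ (Finset.range ((finite_lowG G (x.length + m')).toFinset.card + 1)).card :=
          Finset.card_le_card fun c hc => by
            obtain ⟨D, hD, rfl⟩ := Finset.mem_image.1 hc
            rw [hV] at hD
            obtain ⟨J, -, rfl⟩ := Finset.mem_image.1 hD
            exact Finset.mem_range.2 (Nat.lt_succ_of_le (Finset.card_le_card (hsub J)))
      _ = (finite_lowG G (x.length + m')).toFinset.card + 1 := Finset.card_range _
      _ ≤ x.length + m' + 1 := Nat.succ_le_succ (ncard_lowG_le G hG _)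
  -- every probe lies in the tails of the sensitive set of its `known` value
  obtain ⟨T, hT⟩ : ∃ T : Finset (List Bool) → Finset (List Bool), T = fun D : Finset (List Bool) =>
      ((heavy C' (joinLang Kb (↑D : Set (List Bool))) x.get).filter fun s => s.head? = some true).image
        List.tail := ⟨_, rfl⟩
  have hTcard : ∀ D, (T D).card ≤ smax := fun D => by
    rw [hT, hsmax]
    exact Finset.card_image_le.trans ((Finset.card_filter_le _ _).trans (card_heavy_le C' _ _))
  have hzT : ∀ J ∈ Finset.range (Jm + 1), zf J ∈ V.biUnion T := by
    intro J hJ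
    have hJ' := Nat.lt_succ_iff.1 (Finset.mem_range.1 hJ)
    have hc := mem_cands_of_plan_eq_probe Kb x m' C' (hzf J hJ')
    refine Finset.mem_biUnion.2 ⟨known (results (plan Kb x m' C') G.boolIndicator J), ?_, ?_⟩
    · rw [hV]; exact Finset.mem_image.2 ⟨J, hJ, rfl⟩
    · -- `cands S R ⊆ T` by definition of `cands`
      rw [hT]
      exact Finset.mem_of_mem_filter _ hc
  have hUcard : (V.biUnion T).card ≤ (x.length + m' + 1) * smax :=
    Finset.card_biUnion_le.trans ((Finset.sum_le_card_nsmul _ _ _ fun D _ => hTcard D).trans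
      (by rw [smul_eq_mul]; exact Nat.mul_le_mul_right _ hVcard))
  have hcard := Finset.card_le_card_of_injOn zf hzT hinj
  rw [Finset.card_range] at hcard
  have : Jm + 1 ≤ (x.length + m' + 1) * smax := hcard.trans hUcard
  rw [hJm] at this
  nlinarith

end Halting

/-! ### The verdict is right -/

section Verdict

variable {G : Set (List Bool)} (F : QCircuitFamily cliffordT) {L : Language Bool}

/-- The gate list of a circuit is at most half as long as its code: every gate contributes a
`boolPair`, of length `≥ 2`. [folklore] -/
theorem size_le_length_encode {N : ℕ} (C : QCircuit cliffordT N) : 2 * C.size ≤ C.encode.length := by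
  obtain ⟨gs⟩ := C
  simp only [QCircuit.size, QCircuit.encode]
  induction gs with
  | nil => simp
  | cons g gs ih =>
    simp only [List.foldr_cons, length_boolPair, List.length_cons]
    omega

/-- The number of oracle gates of `F.circ |x|` is at most the length of the reduction code
`redFn F x`. [folklore] -/
theorem oracleQueries_le_length_redFn (x : List Bool) :
    (F.circ x.length).oracleQueries ≤ (BQPCollapse.redFn F x).length := by
  have h1 : (F.circ x.length).oracleQueries ≤ (F.circ x.length).size := List.length_filter_le _ _
  have h2 := size_le_length_encode (F.circ x.length)
  rw [BQPCollapse.redFn_apply, BQPCollapse.code, length_boolPair, QCircuit.sigmaEncode, length_boolPair,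
    length_boolPair]
  omega

/-- The width `|x| + ancillas` is at most the length of the reduction code. [folklore] -/
theorem width_lt_length_redFn (x : List Bool) :
    x.length + F.ancillas x.length < (BQPCollapse.redFn F x).length := by
  rw [BQPCollapse.redFn_apply]
  exact BQPCollapse.lt_length_code _ _ _

/-- **The halting verdict is `[x ∈ L]`.** When the brain of the instance `(x, F.circ |x|)` with base
part `K_{<W}` halts on the true probe answers of `G` (at most one string per length), the strings
of `G` below the width that it has not found avoid the sensitive set of its base oracle `B`, so
`|Pr_C(accept x) − Pr_B(accept x)| ≤ 1/8` for the true oracle `C = K ⊕ G` (BBBV for at most `W`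
modified strings), and the threshold `1/2` separates the promise `≥ 2/3` / `≤ 1/3` of the `BQP^C`
machine. [cite: FortnowRogers1999JCSS, proof of Thm. 4.2 (p. 7) and Thm. 4.3] -/
theorem verdict_iff (hG : ∀ ℓ, {z : List Bool | z ∈ G ∧ z.length = ℓ}.Subsingleton)
    (hF : ∀ x, (x ∈ L → 2 / 3 ≤ F.acceptProbOn (joinLang oracleK G) x) ∧
      (x ∉ L → F.acceptProbOn (joinLang oracleK G) x ≤ 1 / 3))
    (x : List Bool) {J : ℕ} {v : Bool}
    (hJ : plan (trunc oracleK (x.length + F.ancillas x.length)) x (F.ancillas x.length) (F.circ x.length)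
      (results (plan (trunc oracleK (x.length + F.ancillas x.length)) x (F.ancillas x.length) (F.circ x.length))
        G.boolIndicator J) = .halt v) :
    v = true ↔ x ∈ L := by
  classical
  set m := F.ancillas x.length with hm
  set W := x.length + m with hW
  set C := F.circ x.length with hC
  set Kb := trunc oracleK W with hKb
  set pl := plan Kb x m C with hpl
  set R := results pl G.boolIndicator J with hR
  set B := base Kb R with hB
  obtain ⟨hcands, hv⟩ := (plan_eq_halt_iff Kb x m C).1 hJ
  -- the unknown low strings of `G`, as modified oracle strings `1z`
  have hfin : {s : List Bool | ∃ z, s = true :: z ∧ z ∈ G ∧ z.length + 1 < W ∧ z ∉ known R}.Finite := by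
    refine ((finite_lowG G W).image (List.cons true)).subset ?_
    rintro s ⟨z, rfl, hzG, hzl, -⟩
    exact ⟨z, ⟨hzG, by omega⟩, rfl⟩
  set D := hfin.toFinset with hD
  have hmemD : ∀ s, s ∈ D ↔ ∃ z, s = true :: z ∧ z ∈ G ∧ z.length + 1 < W ∧ z ∉ known R := fun s =>
    Set.Finite.mem_toFinset _
  -- (1) `|D| ≤ W`
  have hDcard : D.card ≤ W := by
    have hinj : Set.InjOn List.length (↑D : Set (List Bool)) := by
      intro s hs s' hs' h
      obtain ⟨z, rfl, hz, -, -⟩ := (hmemD s).1 hs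
      obtain ⟨z', rfl, hz', -, -⟩ := (hmemD s').1 hs'
      rw [hG z.length ⟨hz, rfl⟩ ⟨hz', by simpa using h.symm⟩]
    calc D.card = (D.image List.length).card := by rw [Finset.card_image_of_injOn hinj]
      _ ≤ (Finset.range W).card := Finset.card_le_card fun ℓ hℓ => by
          obtain ⟨s, hs, rfl⟩ := Finset.mem_image.1 hℓ
          obtain ⟨z, rfl, -, hzl, -⟩ := (hmemD s).1 hs
          exact Finset.mem_range.2 (by simpa using hzl)
      _ = W := Finset.card_range W
  -- (2) `D` avoids the sensitive set of `B` (no candidate is left, and probed strings of `G` are known)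
  have hdisj : Disjoint D (heavy C B x.get) := by
    rw [Finset.disjoint_left]
    intro s hsD hsS
    obtain ⟨z, rfl, hzG, -, hzk⟩ := (hmemD s).1 hsD
    have hzc : z ∉ cands (heavy C B x.get) R := by rw [hcands]; exact Finset.notMem_empty z
    rw [mem_cands_iff, not_and, not_not] at hzc
    obtain ⟨a, ha⟩ := mem_probed_iff.1 (hzc hsS)
    have ha' := results_answer (plan := pl) G.boolIndicator J ha
    simp only at ha'
    rw [(Set.mem_iff_boolIndicator _ _).1 hzG] at ha'
    subst ha'
    exact hzk (mem_known_iff.2 ha)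
  -- (3) the oracle `B ∪ D` agrees with the true oracle below the width
  set B' : Set (List Bool) := B ∪ ↑D with hB'
  have hagree : ∀ w, w ∉ D → (w ∈ B ↔ w ∈ B') := fun w hw =>
    ⟨fun h => Or.inl h, fun h => h.resolve_right (fun h' => hw (Finset.mem_coe.1 h'))⟩
  have hknownG : ∀ z ∈ known R, z ∈ G := fun z hz =>
    (known_results_subset (x := x) (m' := m) (C' := C) (G := G) Kb J (Finset.mem_coe.2 hz)).1
  have hlow : ∀ w : List Bool, w.length < x.length + m → (w ∈ B' ↔ w ∈ joinLang oracleK G) := by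
    intro w hw
    match w, hw with
    | [], _ => simp [hB', hB, base, hmemD]
    | false :: c, hw =>
      simp only [hB', hB, base, Set.mem_union, false_cons_mem_joinLang, Finset.mem_coe, hmemD, hKb, trunc,
        Set.mem_setOf_eq]
      constructor
      · rintro (⟨h, -⟩ | ⟨z, h, -⟩)
        · exact h
        · cases h
      · intro h
        exact Or.inl ⟨h, by rw [List.length_cons] at hw; omega⟩
    | true :: z, hw =>
      simp only [hB', hB, base, Set.mem_union, true_cons_mem_joinLang, Finset.mem_coe, hmemD]
      constructor
      · rintro (h | ⟨z', h, hz', -, -⟩)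
        · exact hknownG z h
        · cases h; exact hz'
      · intro h
        by_cases hk : z ∈ known R
        · exact Or.inl hk
        · exact Or.inr ⟨z, rfl, h, by simpa using hw, hk⟩
  have hacc : C.acceptProb B' x.get = F.acceptProbOn (joinLang oracleK G) x :=
    C.acceptProb_congr hlow x.get
  -- (4) BBBV: `|Pr_{B'} − Pr_B| ≤ 1/8`
  have hbbbv := (heavy_spec C B x.get).2.2 B' D hDcard hdisj hagree
  rw [hacc] at hbbbv
  -- (5) threshold
  rw [hv]
  have h1 := (hF x).1
  have h2 := (hF x).2
  constructor
  · intro hv'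
    have hle : (1 / 2 : ℝ) ≤ C.acceptProb B x.get := of_decide_eq_true hv'
    by_contra hx
    have := h2 hx
    rw [abs_le] at hbbbv
    linarith [hbbbv.1]
  · intro hx
    have := h1 hx
    rw [abs_le] at hbbbv
    exact decide_eq_true (by linarith [hbbbv.2])

end Verdict

/-! ### `BQP^{K ⊕ G} ⊆ P^{K ⊕ G}` -/

/-- The round budget of the protocol machine, in the length bound `s` of the reduction code:
`(s + 1)(256 s³ + 1)(2s + 5) + 1`. [folklore] -/
def budget (s : Polynomial ℕ) : Polynomial ℕ :=
  ((s + 1) * (256 * s ^ 3 + 1)) * (2 * s + 5) + 1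

/-- Evaluation of the budget. [folklore] -/
theorem budget_eval (s : Polynomial ℕ) (n : ℕ) :
    (budget s).eval n = ((s.eval n + 1) * (256 * s.eval n ^ 3 + 1)) * (2 * s.eval n + 5) + 1 := by
  simp [budget]

/-- **Fortnow–Rogers: `BQP^{K ⊕ G} ⊆ P^{K ⊕ G}`** for the brain oracle `K` and every `G` with at
most one string of each length. A `BQP^{K ⊕ G}` language `L`, witnessed by the uniform family `F`,
is the protocol language `protoLang (redFn F) q K G` of `BrainProtocol.lean` (payload = the code
`⟨x, sigmaEncode ⟨|x|, ancillas, circuit⟩⟩`, in `FP` by uniformity) for the round budget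
`q = budget s`, `s` a length bound of the code; and protocol languages are in `P^{K ⊕ G}`.
[cite: FortnowRogers1999JCSS, Thm. 4.2 and its proof (p. 7: "Next we show that P^C = BQP^C")] -/
theorem BQPRel_joinLang_oracleK_subset_PRel (G : Set (List Bool))
    (hG : ∀ ℓ, {z : List Bool | z ∈ G ∧ z.length = ℓ}.Subsingleton) :
    BQPRel (joinLang oracleK G) ⊆ PRel (Oracle.ofLanguage (joinLang oracleK G)) := by
  rintro L ⟨F, hU, hF⟩
  obtain ⟨s, hs⟩ := exists_poly_length_le_of_mem_FP (BQPCollapse.redFn_mem_FP F hU)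
  suffices h : L = protoLang (BQPCollapse.redFn F) (budget s) oracleK G by
    rw [h]; exact protoLang_mem_PRel (BQPCollapse.redFn_mem_FP F hU) _ _ _
  ext x
  set m := F.ancillas x.length with hm
  set W := x.length + m with hW
  set C := F.circ x.length with hC
  set pl := plan (trunc oracleK W) x m C with hpl
  -- `K` answers the questions of the instance
  have hK : ∀ h : List Bool, boolPair (BQPCollapse.redFn F x) h ∈ oracleK ↔ kbit pl h = true := by
    intro h
    rw [BQPCollapse.redFn_apply]
    exact mem_oracleK_question_iff x m C h
  -- the loop halts, with the right verdict, within the budget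
  obtain ⟨J, hJ, v, hv⟩ := exists_halt (x := x) (m' := m) (C' := C) (trunc oracleK W) hG
  have hverd : v = true ↔ x ∈ L := verdict_iff F hG hF x hv
  have hlen : ∀ J' z, pl (results pl G.boolIndicator J') = .probe z → z.length ≤ W := fun J' z h =>
    by have := length_lt_of_plan_eq_probe (trunc oracleK W) x m C h; omega
  have hsx := hs x
  have hT := oracleQueries_le_length_redFn F x
  have hWs := width_lt_length_redFn F x
  have hq : J * (2 * W + 5) < (budget s).eval x.length := by
    rw [budget_eval]
    have h1 : J ≤ (s.eval x.length + 1) * (256 * s.eval x.length ^ 3 + 1) := by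
      refine hJ.trans ?_
      have hW' : W ≤ s.eval x.length := by omega
      have hT' : C.oracleQueries ≤ s.eval x.length := hT.trans hsx
      have : 256 * C.oracleQueries ^ 2 * W ≤ 256 * s.eval x.length ^ 3 := by
        calc 256 * C.oracleQueries ^ 2 * W ≤ 256 * s.eval x.length ^ 2 * s.eval x.length := by gcongr
          _ = 256 * s.eval x.length ^ 3 := by ring
      gcongr
    have h2 : 2 * W + 5 ≤ 2 * s.eval x.length + 5 := by omega
    calc J * (2 * W + 5) ≤ (s.eval x.length + 1) * (256 * s.eval x.length ^ 3 + 1) * (2 * s.eval x.length + 5) :=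
          Nat.mul_le_mul h1 h2
      _ < _ := Nat.lt_succ_self _
  rw [mem_protoLang_iff_of_le (plan := pl) hK hv hlen hq]
  exact hverd.symm

/-- **There is an oracle part `K` with `BQP^{K ⊕ G} ⊆ P^{K ⊕ G}` for all thin `G`** (packaged;
one conjunct of the printed theorem). [cite: FortnowRogers1999JCSS, proof of Thm. 4.2, second half (arXiv numbering, p. 7)] -/
theorem exists_brain :
    ∃ K : Set (List Bool), ∀ G : Set (List Bool), (∀ ℓ, {z : List Bool | z ∈ G ∧ z.length = ℓ}.Subsingleton) →
      BQPRel (joinLang K G) ⊆ PRel (Oracle.ofLanguage (joinLang K G)) :=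
  ⟨oracleK, BQPRel_joinLang_oracleK_subset_PRel⟩

end FRBrain

end Literature.Computability.QuantumComplexity

end
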